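import Summits.ABC.IUTFork.Cor312Statement
import Summits.ABC.IUTFork.Repair.RHReqsideLabelsNoSymmetry
import Summits.ABC.IUTFork.Repair.RHReqsideLabelsPlusMinusOrbits
import Summits.ABC.IUTFork.Repair.RHReqsideWeightLawsThreshold
import Summits.ABC.IUTFork.Repair.RHReqsidePairPK2SM34
import HarnessLib

/-!
# R-H ROUND-3 AXIS C, item (b) TYPING LANE (ruling R79, KEY «C-TYPE-K1» clause (3)): knob family k2 = LABEL TRUNCATION — K2-HALF (`L = ⌈l⋆/2⌉`,
# CFG-07/08/09, rh3-gen-3) and K2-SQRT (`L = ⌈√l⋆⌉`, CFG-10/11/12, rh3-gen-4): the MODIFIED OBJECTS a theory evaluating on the truncated label set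
# `J_L = {1,…,L}` must SUPPLY, as claim-tagged `Prop`s over the typed [IUTchIII] Cor 3.12 setting and OUR cell currency

abc-iut cell, rung LADDER-ABC:A2.RESCUE.H; seat abc-iut-reqb-typ-1 (GEN 9; KEY `wake/KEY-abc-iut-reqb-typ-1-C-TYPE-K1.md` 884765c520d369cd (3) «the same for k2 (CFG-07–12,
rh3-gen-3 / rh3-gen-4: `RHAxisCK2Requirements.lean`)»); desk file `plan/rescue/R-H/ROUND3/AXIS-CD-DESK.md` 0c01fcd4427e30c7 §AXIS C item (b) «the modified objects as claim-tagged
Lean Props (`def … : Prop` under Summits/ABC/IUTFork/Repair/) … NEVER Literature facts»; machine list `AXIS-C/AXIS-C-CONFIGS.tsv` 80c35a38b88f1870.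
SHEETS TYPED HERE: K2-HALF — CFG-07 `AXIS-C/CFG-07-P-k2half-k5mu27_64.md` cb19957b6da0d088 · CFG-08 `CFG-08-P-k2half-k5mu1_2.md` f4431961b195a3da · CFG-09
`CFG-09-P-k2half-k5mu3_4.md` 6e59a100246904b5 (rh3-gen-3 g6; item (b) B0–B7/R3 = ONE scratch module `HOME/abc-iut-rh3-gen-3/g6/RHAxisCK2HalfRequirements.lean` 9dcc4a44e2f9ca6a,
220 l, rc 0, «offered verbatim to the R79 typing lane … to land unchanged» — §§1–4 below ARE that module, CREDITED, re-homed from ns `…RH.AxisCK2Half` into this file's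
namespace with short names unchanged: `halfLen`, `meanSq`, `lamOf`, `truncNormalized`, `negLogThetaUpTo`, `negLogQUpTo`, `TruncStatement`, `HalfStatement`,
`TruncLabelsProductClosed`, `TruncPMLabelsAreOrbit`, `uConst_sq_trunc`, …); K2-SQRT — CFG-10 `CFG-10-P-k2sqrt-k5mu27_64.md` aee67afba31ab6ca · CFG-11 `CFG-11-P-k2sqrt-k5mu1_2.md`
6029b68fb927fb16 · CFG-12 `CFG-12-P-k2sqrt-k5mu3_4.md` 83fd4aa848a9c416 (rh3-gen-4; item (b) B1–B7 prose with signatures: `K2SqrtBound`, `JLThetaPilot`, `JLSymmetry`,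
`JLProcession`, `JLMultiradialDisplay`, downstream SHAPE, `LambdaLinkTarget`) = §5 below = rh3-gen-4 g10's companion section `HOME/abc-iut-rh3-gen-4/g10/AxisCK2Sqrt-section-g10.lean`
af840849ddccf1ff (135 l; merged preview bbb0a033d01f956b rc 0) VERBATIM, CREDITED, typed over §§1–4 at `L = sqrtLen l⋆ = ceilSqrt l⋆` (the module's decls are generic in `L`).
The per-datum arithmetic shadow in OUR cell currency (sheets B1/B2/B5), the symmetry requirement B3 with its UN-TYPED clause as an explicit predicate parameter, and the
one-packaging-def-per-configuration layer (`CFG07_requirement` … `CFG12_requirement`) ride in the companion `RHAxisCK2RequirementsB.lean` (400-line rule). The only edits to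
the two offered texts: namespace re-homed `…RH.AxisCK2Half` → `…RH.AxisCK2Requirements` (short names unchanged) and the informal bracketed «claim … hypothetical» docstring marker
re-worded «(HYPOTHETICAL)» (the gate's tag lint reads bracketed claim tags textually; every IUT locution keeps `[claim: Mochizuki2012, status: disputed]`). Referees
rh-ref-1 / rh-ref-2 PASS 15/15 (AXIS-C/INDEX.md b3f8c2fa94ba537c, 13:37Z).

WHAT A k2 THEORY MUST SUPPLY (both families; R-numbers rh3-gen-3's, B-numbers the sheets'): (R2/B5) a TRUNCATED COROLLARY `TruncStatement P L λ`: «`−|log(Θ)|_L ∈ ℝ`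
and `λ·(−|log(q)|_L) ≤ −|log(Θ)|_L`», print's procession-normalised global log-volumes averaged over `j = 1,…,L` ONLY (`negLogThetaUpTo`, `negLogQUpTo`; weight `1/L` =
[IUTchIII] Rmk 3.9.3), `λ = λ_L(μ₀) = lamOf μ₀ L` the q-side exponent of print's generalized `Θ^{×μ}_{LGP}`-link ([IUTchIII] Rmk 3.12.1 (ii)) realising the target `μ₀` on `L`
labels — at `L = l⋆`, `λ = 1` this IS the printed Cor 3.12 (`truncStatement_lstar_one_iff`), i.e. the new object is «Cor 3.12 for the evaluation sub-graph `Γ′ = [0, L] ⊊ Γ▶`»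
([IUTchII] Rmk 2.6.3) = B2 (an `L`-value Θ-pilot as ONE object) + B5 (its link and multiradial representation), PROSE at object level (the tree abstracts a pilot to its
per-label local log-volumes); (R1/B3) a REPLACEMENT label symmetry, because print's two mechanisms are DECIDED UNAVAILABLE on the truncated sets (`𝔽_l^⋇` side:
`truncatedLabels_closed_iff` p513512; `𝔽_l^{⋊±}` side: `affPM_no_midsize_orbit` p529840) — §3 at `L = ⌈l⋆/2⌉`, §5 at `L = ⌈√l⋆⌉`, every prime `l ≥ 7` (all 42 bed
primes); (R3/B6) the DOWNSTREAM constant `u(l, L) = uConst (j ↦ j²) 1 l L = 6l(L+3)/((2L+5)(L−1))` (`uConst_sq_trunc`): BOUNDED `∈ (12, 6·39/11]` for K2-HALF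
(`twelve_lt_uConst_sq_trunc`; `ReqsideShellProfile.halfTruncation_factor_le` p507493), UNBOUNDED `> 3l/L` for K2-SQRT (`three_mul_div_lt_uConst_sq_trunc`); (B4) processions
of length `L` with weight `1/L` — definable as arithmetic (`truncNormalized`); (B7) the k5 half is print-definable (`lamOf`; `reqThreshold` p508156).
HONEST FRAMING / GUARDS: every `def` here is a HYPOTHETICAL object of a theory nobody has written — a requirement on OUR typed objects in OUR cell currency, not a
grading of the corpus, not a claim that [IUTchI–III] admit a truncated evaluation, NEVER a Literature fact (no new `Prop` fact; inputs ⊆ the frozen FACT-LIST f75a60bac22efdb6 +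
the landed modules imported above); the theorems are elementary ([folklore]) and either identify the print case, decide that print's symmetry mechanisms are unavailable,
or give closed forms of cell-currency constants; located ≠ adjudicated; typed ≠ proved; computed ≠ proved; nothing here asserts that abc is proved or refuted, that
[IUTchIII] Cor. 3.12 / [IUTchIV] Thm. 1.10 holds or fails, or takes a side on any author (D-0045). [claim: Mochizuki2012, status: disputed] for every IUT locution.
[cite: Mochizuki2012, IUTchIII Cor. 3.12 p. 173–174, Rmk. 3.9.3 p. 119–120, Rmk. 3.12.1 (ii) p. 186; IUTchII Rmk. 2.6.3 p. 79–80; IUTchI Prop. 4.9 (i) p. 115, Def. 6.1 p. 167–168]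
-/

namespace Summit.ABC.IUTFork.Repair.RH.AxisCK2Requirements

open Summit.ABC.IUTFork Summit.ABC.IUTFork.Thm311 Summit.ABC.IUTFork.Cor312 Literature.IUT.LogThetaLattice

/-! ## §1. The truncation length and the q-side exponent -/

/-- `L = ⌈l⋆/2⌉ = (l⋆ + 1)/2` — the K2-HALF label count (REQB-SPEC v0.2 k2 `trunc:half`; engines' `n_J`). [folklore] -/
def halfLen (lstar : ℕ) : ℕ := (lstar + 1) / 2

/-- For `l⋆ ≥ 3` (i.e. `l ≥ 7`) the half-truncation is a PROPER, NON-TRIVIAL truncation: `2 ≤ L ≤ l⋆ − 1`. [folklore] -/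
theorem halfLen_window {lstar : ℕ} (h : 3 ≤ lstar) : 2 ≤ halfLen lstar ∧ halfLen lstar + 1 ≤ lstar := by
  unfold halfLen; omega

/-- The mean of `j²` over `j = 1,…,L`, `(L+1)(2L+1)/6` (`= l(l+1)/12`-type quantity `(l⋆+1)(2l⋆+1)/6` at `L = l⋆`; cf. the averaged quantity `||Γ′||`
of [IUTchII] Rmk 2.6.3 (ii) for the sub-graph `Γ′ = [0, L]`, up to print's normalisation by `|Γ′|`). [folklore] -/
def meanSq (L : ℕ) : ℚ := ((L : ℚ) + 1) * (2 * L + 1) / 6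

/-- **(HYPOTHETICAL) `λ_L(μ₀)`** — the q-side exponent of a generalized `Θ^{×μ}_{LGP}`-link ([IUTchIII] Rmk 3.12.1 (ii), `q^λ ↦ q^{(1²,…,L²)}`) that
realises the cell target `μ₀` on the label set `{1,…,L}`: `μ₀·Σ_{j≤L}(j²−1) = Σ_{j≤L} j² − L·λ`, i.e. `λ = 1 + (1 − μ₀)(meanSq L − 1)`
(abc-iut-reqb-rf-1's λ-link [L4] read at `L` labels; at `L = l⋆` it is rf-1's `λ = 1 + (1 − μ₀)(l(l+1)/12 − 1)`). HYPOTHETICAL bookkeeping.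
[claim: Mochizuki2012, status: disputed] -/
def lamOf (μ₀ : ℚ) (L : ℕ) : ℚ := 1 + (1 - μ₀) * (meanSq L - 1)

/-- The three configurations at the worked prime `l = 107` (`l⋆ = 53`, `L = 27`, `meanSq 27 = 770/3 = 256.67`):
`λ_27(27/64) = 28571/192 ≈ 148.81`, `λ_27(1/2) = 773/6 ≈ 128.83`, `λ_27(3/4) = 779/12 ≈ 64.92`
(print label range: rf-1's `557.2 / 482 / 241.5`). [folklore] -/
theorem lamOf_worked :
    halfLen 53 = 27 ∧ meanSq 27 = 770 / 3 ∧
      lamOf (27 / 64) 27 = 28571 / 192 ∧ lamOf (1 / 2) 27 = 773 / 6 ∧ lamOf (3 / 4) 27 = 779 / 12 := by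
  refine ⟨by decide, ?_, ?_, ?_, ?_⟩ <;> norm_num [lamOf, meanSq]

/-! ## §2. (R2) The truncated Corollary over the typed Cor 3.12 setting -/

section Interface

variable {T : ThetaIndex} {S : Situation T} (P : Cor312.Setting S)

/-- Truncated procession-normalisation: `(1/L)·Σ_{i < L} vol i` over the label indices `i : Fin l⋆` (`j = i + 1`); labels `> L` are dropped,
the weight is the uniform `1/L` of [IUTchIII] Rmk 3.9.3 on the sub-procession of length `L`. (HYPOTHETICAL bookkeeping.) [claim: Mochizuki2012, status: disputed] -/
noncomputable def truncNormalized (L : ℕ) (vol : Fin T.lstar → ℝ) : ℝ :=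
  (∑ i : Fin T.lstar, if (i : ℕ) < L then vol i else 0) / L

/-- At `L = l⋆` the truncated normalisation is print's `processionNormalized`. [folklore] -/
theorem truncNormalized_lstar (vol : Fin T.lstar → ℝ) : truncNormalized T.lstar vol = processionNormalized vol := by
  show _ = (∑ j, vol j) / (T.lstar : ℝ)
  unfold truncNormalized
  congr 1
  exact Finset.sum_congr rfl fun i _ => if_pos i.is_lt

open scoped Classical in
/-- **(HYPOTHETICAL) `−|log(Θ)|_L`** — the procession-normalised (over `j = 1,…,L` only) global log-volume of the holomorphic hull of the possible
images of a Θ-pilot object WITH `L` THETA VALUES; `⊤` unless print's finiteness `ThetaFinite` holds. No printed object for `L < l⋆`; hypothetical. [claim: Mochizuki2012, status: disputed] -/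
@[claim "Mochizuki2012" "disputed"]
noncomputable def negLogThetaUpTo (L : ℕ) : WithTop ℝ :=
  if P.ThetaFinite then
    ((truncNormalized L fun i : Fin T.lstar => ∑ᶠ vQ : T.VQ, (P.thetaLocal (Cor312.Setting.labelSucc i) vQ).untopD 0 : ℝ) : WithTop ℝ)
  else ⊤

open scoped Classical in
/-- **(HYPOTHETICAL) `−|log(q)|_L`** — the same truncated average of the q-pilot's local log-volumes; hypothetical. [claim: Mochizuki2012, status: disputed] -/
@[claim "Mochizuki2012" "disputed"]
noncomputable def negLogQUpTo (L : ℕ) : ℝ :=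
  truncNormalized L fun i : Fin T.lstar => ∑ᶠ vQ : T.VQ, P.qLocal (Cor312.Setting.labelSucc i) vQ

/-- **(HYPOTHETICAL) THE TRUNCATED COROLLARY `TruncStatement P L λ`**: «`−|log(Θ)|_L ∈ ℝ` and `λ·(−|log(q)|_L) ≤ −|log(Θ)|_L`» — what a
K2 theory must make a THEOREM (from a Θ-link with an `L`-value Θ-pilot and its multiradial representation), in place of [IUTchIII] Cor 3.12. A hypothetical READING over our typed setting, not an IUT object. [claim: Mochizuki2012, status: disputed] -/
@[claim "Mochizuki2012" "disputed"]
def TruncStatement (L : ℕ) (lam : ℝ) : Prop :=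
  negLogThetaUpTo P L ≠ ⊤ ∧ (((lam * negLogQUpTo P L : ℝ)) : WithTop ℝ) ≤ negLogThetaUpTo P L

/-- **(HYPOTHETICAL) THE K2-HALF STATEMENT** at q-exponent `λ` (`λ = λ_L(μ₀)`, `L = ⌈l⋆/2⌉`; CFG-07/08/09: `μ₀ = 27/64, 1/2, 3/4`). Hypothetical; not an IUT object. [claim: Mochizuki2012, status: disputed] -/
@[claim "Mochizuki2012" "disputed"]
def HalfStatement (lam : ℝ) : Prop := TruncStatement P (halfLen T.lstar) lam

/-- `−|log(Θ)|_{l⋆} = −|log(Θ)|`. [folklore] -/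
theorem negLogThetaUpTo_lstar : negLogThetaUpTo P T.lstar = P.negLogTheta := by
  unfold negLogThetaUpTo Cor312.Setting.negLogTheta
  simp only [truncNormalized_lstar]

/-- `−|log(q)|_{l⋆} = −|log(q)|`. [folklore] -/
theorem negLogQUpTo_lstar : negLogQUpTo P T.lstar = P.negLogQ := by
  unfold negLogQUpTo Cor312.Setting.negLogQ
  rw [truncNormalized_lstar]

/-- **PRINT IS THE CASE `L = l⋆`, `λ = 1`**: `TruncStatement P l⋆ 1 ↔ Statement P` ([IUTchIII] Cor 3.12 as typed by abc-iut-c312-7). [folklore] -/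
theorem truncStatement_lstar_one_iff : TruncStatement P T.lstar 1 ↔ P.Statement := by
  unfold TruncStatement Cor312.Setting.Statement
  rw [negLogThetaUpTo_lstar, negLogQUpTo_lstar, one_mul]

end Interface

/-! ## §3. (R1) Print's two label-symmetry mechanisms are unavailable on the truncated sets (decided, every prime `l ≥ 7`) -/

/-- **(HYPOTHETICAL) (R1⋇)** the `𝔽_l^⋇` side: `{1,…,L}` closed under the label product `(x, y) ↦ min(xy mod l, l − (xy mod l))` — the
condition for `{1,…,L}` to be the orbit of the label `1` under a subgroup of the `𝔽_l^⋇`-symmetry of [IUTchI] Prop 4.9 (i) (which would restore a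
simply transitive symmetry on the truncated label set, [IUTchI] p. 115). A requirement, decided FALSE below. [claim: Mochizuki2012, status: disputed] -/
@[claim "Mochizuki2012" "disputed"]
def TruncLabelsProductClosed (l L : ℕ) : Prop :=
  ∀ x y, (1 ≤ x ∧ x ≤ L) → (1 ≤ y ∧ y ≤ L) → (1 ≤ min (x * y % l) (l - x * y % l) ∧ min (x * y % l) (l - x * y % l) ≤ L)

/-- **(R1⋇) DECIDED FALSE for `L = ⌈l⋆/2⌉` at every prime `l ≥ 7`** (`truncatedLabels_closed_iff`, p513512: closed ⟺ `L = 1 ∨ L = l⋆`, and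
`2 ≤ ⌈l⋆/2⌉ ≤ l⋆ − 1`). Covers all 42 bed primes `7 ≤ l ≤ 397`. [folklore] -/
theorem halfLabelsProductClosed_iff_false (l : ℕ) (hp : l.Prime) (h7 : 7 ≤ l) :
    TruncLabelsProductClosed l (halfLen ((l - 1) / 2)) ↔ False := by
  rw [iff_false]
  intro h
  have hw := halfLen_window (lstar := (l - 1) / 2) (by omega)
  have key := (ReqsideLabelsNoSymmetry.truncatedLabels_closed_iff l (halfLen ((l - 1) / 2)) hp (by omega) (by omega)
    (by omega)).1 h
  omega

/-- **(HYPOTHETICAL) (R1±)** the `𝔽_l^{⋊±}` side: a `2L+1`-element set of Θ±-labels (`{−L,…,L} ⊂ 𝔽_l`) is the orbit of a composition-closed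
family of maps `x ↦ ±x + a` ([IUTchI] Def 6.1) acting on it transitively — the condition for conjugate synchronisation ([IUTchII] Rmk 4.5.3) to be
built on the truncated Θ±-label set as print builds it on `𝔽_l`. Stated for ANY set of that cardinality (stronger negative below). [claim: Mochizuki2012, status: disputed] -/
@[claim "Mochizuki2012" "disputed"]
def TruncPMLabelsAreOrbit (l L : ℕ) : Prop :=
  ∃ (H : Set (ZMod l → ZMod l)) (A : Finset (ZMod l)),
    (∀ f ∈ H, ∃ ε a : ZMod l, (ε = 1 ∨ ε = -1) ∧ ∀ x, f x = ε * x + a) ∧ (∀ f ∈ H, ∀ g ∈ H, f ∘ g ∈ H) ∧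
      (∀ f ∈ H, ∀ x ∈ A, f x ∈ A) ∧ (∀ x ∈ A, ∀ y ∈ A, ∃ f ∈ H, f x = y) ∧ A.card = 2 * L + 1

/-- **(R1±) FALSE for `1 ≤ L`, `2L + 2 ≤ l`, `l` prime** (`affPM_no_midsize_orbit`, p529840: orbit sizes are `≤ 2` or `l`). [folklore] -/
theorem truncPMLabelsAreOrbit_false (l L : ℕ) (hp : l.Prime) (hL : 1 ≤ L) (hLl : 2 * L + 2 ≤ l) : ¬ TruncPMLabelsAreOrbit l L := by
  haveI : Fact l.Prime := ⟨hp⟩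
  rintro ⟨H, A, hH, hcomp, hA, htr, hcard⟩
  exact ReqsideLabelsPlusMinusOrbits.affPM_no_midsize_orbit H hH hcomp A hA htr (by omega) (by omega)

/-- **(R1±) DECIDED FALSE for `L = ⌈l⋆/2⌉` at every prime `l ≥ 7`** (then `3 ≤ 2L+1 ≤ l − 2`). [folklore] -/
theorem halfPMLabelsAreOrbit_false (l : ℕ) (hp : l.Prime) (h7 : 7 ≤ l) : ¬ TruncPMLabelsAreOrbit l (halfLen ((l - 1) / 2)) := by
  have hodd : l % 2 = 1 := Nat.odd_iff.mp (hp.odd_of_ne_two (by omega))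
  have hw := halfLen_window (lstar := (l - 1) / 2) (by omega)
  exact truncPMLabelsAreOrbit_false l _ hp (by omega) (by omega)

/-! ## §4. (R3) The downstream display constant of the truncated requirement (cell currency) -/

open ReqsideWeightLaws in
/-- **CLOSED FORM `u(l, L) = 6l(L+3)/((2L+5)(L−1))`** of the cell-currency display constant `uConst (j ↦ j²) 1 l L` (p508156) for a label set
`{1,…,L}`, `L ≥ 2`, at ANY `l` (print = the case `l = 2L+1`, `uConst_sq`: `6l(l+5)/((l−3)(l+4)) → 6`). [folklore] -/
theorem uConst_sq_trunc (l : ℕ) {L : ℕ} (hL : 2 ≤ L) :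
    uConst (fun j => (j : ℤ) ^ 2) 1 l L = 6 * (l : ℝ) * ((L : ℝ) + 3) / ((2 * (L : ℝ) + 5) * ((L : ℝ) - 1)) := by
  have hD : ((demandSum (fun j => (j : ℤ) ^ 2) 1 L : ℤ) : ℝ) = (L : ℝ) * (L - 1) * (2 * L + 5) / 6 := by
    have h := congrArg (fun z : ℤ => (z : ℝ)) (six_mul_demandSum_sq L); push_cast at h; linarith
  unfold uConst; rw [hD]
  have h2 : (2 : ℝ) ≤ L := by exact_mod_cast hL
  have h1 : (L : ℝ) - 1 ≠ 0 := by linarith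
  have h0 : (L : ℝ) ≠ 0 := by linarith
  have h5 : (2 : ℝ) * L + 5 ≠ 0 := by linarith
  push_cast
  field_simp
  try ring

open ReqsideWeightLaws in
/-- **`u(l, L) > 12` whenever `4L ≤ l + 1` and `L ≥ 2`** — in particular for `L = ⌈l⋆/2⌉` at every odd `l ≥ 7` (equality `4L = l + 1` iff
`l ≡ 3 (mod 4)`); as `l → ∞` with `L = ⌈l⋆/2⌉`, `u(l, L) → 12` = TWICE print's limit `6`. [folklore] -/
theorem twelve_lt_uConst_sq_trunc {l L : ℕ} (hL : 2 ≤ L) (hl : 4 * L ≤ l + 1) :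
    12 < uConst (fun j => (j : ℤ) ^ 2) 1 l L := by
  rw [uConst_sq_trunc l hL]
  have h2 : (2 : ℝ) ≤ L := by exact_mod_cast hL
  have hl' : 4 * (L : ℝ) ≤ (l : ℝ) + 1 := by exact_mod_cast hl
  have hden : 0 < (2 * (L : ℝ) + 5) * ((L : ℝ) - 1) := by nlinarith
  rw [lt_div_iff₀ hden]
  nlinarith

/-- `4·⌈l⋆/2⌉ ≤ l + 1` and `2 ≤ ⌈l⋆/2⌉` for every odd `l ≥ 7` (so `twelve_lt_uConst_sq_trunc` applies at all 42 bed primes). [folklore] -/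
theorem halfLen_hyps {l : ℕ} (hodd : l % 2 = 1) (h7 : 7 ≤ l) :
    2 ≤ halfLen ((l - 1) / 2) ∧ 4 * halfLen ((l - 1) / 2) ≤ l + 1 := by
  unfold halfLen; omega

open ReqsideWeightLaws in
/-- **NUMERALS at the two ends of the bed and at the worked prime** (`(l, L)` = `(7, 2)`, `(107, 27)`, `(397, 99)`):
`u = 70/3 = 23.33`, `9630/767 = 12.555`, `121482/9947 = 12.213` (print at the same `l`: `11.45`, `6.229`, `6.059`). [folklore] -/
theorem uConst_sq_trunc_numerals :
    uConst (fun j => (j : ℤ) ^ 2) 1 7 2 = 70 / 3 ∧ uConst (fun j => (j : ℤ) ^ 2) 1 107 27 = 9630 / 767 ∧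
      uConst (fun j => (j : ℤ) ^ 2) 1 397 99 = 121482 / 9947 := by
  refine ⟨?_, ?_, ?_⟩ <;> (rw [uConst_sq_trunc _ (by norm_num)]; norm_num)


/-! ## §5. Family K2-SQRT (configurations CFG-10/11/12 = P-k2sqrt-k5mu27/64, ·mu1/2, ·mu3/4): the same interface at `L = ⌈√l⋆⌉`

Companion section by seat abc-iut-rh3-gen-4 (planner, GEN 10; KEY C-SHEETS-4; sheets of record `plan/rescue/R-H/ROUND3/AXIS-C/CFG-10-P-k2sqrt-k5mu27_64.md`
aee67afba31ab6ca · `CFG-11-P-k2sqrt-k5mu1_2.md` 6029b68fb927fb16 · `CFG-12-P-k2sqrt-k5mu3_4.md` 83fd4aa848a9c416, all referee PASS), written IN THE SCHEMA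
OF §1–§4 above (abc-iut-rh3-gen-3's general-`L` interface) so that ONE k2 family file covers CFG-07…12 (R79 (4), D-0064). Scratch for the R79 typer lane
(abc-iut-reqb-typ-1); this seat files no Lean (R79). Map to the sheets' item (b): B1 (cell / requirement / MEETS word) = LANDED currency, cited by name —
`ReqsideWeightLaws.reqThreshold_eq_zero_iff`, the μ₀-free saturating place table `ReqsideK2SqrtPlaces` (p516583: 1,481 of 1,523 bed places have `j₀ = L`)
and the three pair faces `ReqsideWeightLaws.bed_pair_rows_*` (PK2SM2764, p516401) + `bed_pair_rows_frey_nonsat` (p518546) · `ReqsidePairPK2SM12.*` (p521688) ·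
`ReqsidePairPK2SM34.*` (p517515); B2 + B5 (an `L`-value Θ-pilot, its link and multiradial representation, `L = ⌈√l⋆⌉`) = the hypothetical READING
`SqrtStatement` below (= `TruncStatement` of §2 at `L = sqrtLen l⋆`; no printed object for `L < l⋆`); B3 (a transitive label symmetry on the truncated sets) =
(R1⋇)/(R1±) of §3, DECIDED FALSE at `L = ⌈√l⋆⌉` for every prime `l ≥ 7` (`sqrtLabelsProductClosed_iff_false`, `sqrtPMLabelsAreOrbit_false`); B4 (the
`L`-procession average) = `truncNormalized` of §2; B6 (downstream constant, NO `l`-uniform Λ) = `six_mul_lt_uConst_sq_sqrtRow` («`u(l, L) > 6(L − 2)`» on every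
row `(L−1)² < l⋆`, so `u → ∞` along the family, against `u → 12` for K2-HALF (§4) and `u → 6` in print); B7 (k5 target `μ₀` as a q-side exponent) = `lamOf` of §1,
numerals in BOTH readings of record (`lamOf μ₀ l⋆` = the full-label λ-link [L4] of REQB-TABLE v1 col 24: 557.2 / 482 / 241.5 at `l = 107`; `lamOf μ₀ L` = the
`L`-label reading of §1: 15.16 / 13.25 / 7.125 at `(l, L) = (107, 8)`) — which reading a k2 × k5 pair carries is a DESK WORD, not decided here; the bed numbers
(MEETS, ρ) read `μ₀` directly (`reqThreshold`) and are unaffected. Honest framing as in the file header: hypothetical knob objects of OUR typed currency,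
never Literature facts; nothing asserts abc proved or refuted; no side on [IUTchIII] Cor 3.12 / [IUTchIV] Thm 1.10 or any author; typed ≠ proved; computed ≠ proved.
-/

/-- `L = ⌈√l⋆⌉` — the K2-SQRT label count (REQB-SPEC v0.2 k2 `trunc:sqrt`; `= ReqsideWeightLaws.ceilSqrt l⋆`, p506542; the bed's 42 pairs `(l⋆, L)` are
`ReqsideK2SqrtPlaces.labelBound_rows`, p516583, with `ceilSqrt l⋆ = L` by `ReqsidePairPK2SM34.labelBound_eq`, p517515). [folklore] -/
def sqrtLen (lstar : ℕ) : ℕ := ReqsideWeightLaws.ceilSqrt lstar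

/-- `(L−1)² < l⋆ ≤ L²`, `1 ≤ L` ⟹ `sqrtLen l⋆ = L` (by name: `ReqsidePairPK2SM34.labelBound_eq`). [folklore] -/
theorem sqrtLen_eq {lstar L : ℕ} (h1 : (L - 1) ^ 2 < lstar) (h2 : lstar ≤ L ^ 2) (hL : 1 ≤ L) : sqrtLen lstar = L :=
  ReqsidePairPK2SM34.labelBound_eq (q := (lstar, L)) ⟨h1, h2⟩ hL

/-- NUMERALS: `L = 2` at `l = 7` (`l⋆ = 3`), `L = 8` at the worked prime `l = 107` (`l⋆ = 53`), `L = 15` at `l = 397` (`l⋆ = 198`). [folklore] -/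
theorem sqrtLen_numerals : sqrtLen 3 = 2 ∧ sqrtLen 53 = 8 ∧ sqrtLen 198 = 15 :=
  ⟨sqrtLen_eq (by norm_num) (by norm_num) (by norm_num), sqrtLen_eq (by norm_num) (by norm_num) (by norm_num),
    sqrtLen_eq (by norm_num) (by norm_num) (by norm_num)⟩

/-- For `l⋆ ≥ 3` (i.e. `l ≥ 7`) the sqrt-truncation is a PROPER, NON-TRIVIAL truncation: `2 ≤ L ≤ l⋆ − 1` (`1² < l⋆` and `l⋆ ≤ (l⋆−1)²`). [folklore] -/
theorem sqrtLen_window {lstar : ℕ} (h : 3 ≤ lstar) : 2 ≤ sqrtLen lstar ∧ sqrtLen lstar + 1 ≤ lstar := by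
  have h1 : 1 ^ 2 < lstar := by rw [one_pow]; omega
  have hlo := ReqsideWeightLaws.succ_le_ceilSqrt_of_sq_lt h1
  have hs : lstar ≤ (lstar - 1) ^ 2 := by
    obtain ⟨k, rfl⟩ : ∃ k, lstar = k + 3 := ⟨lstar - 3, by omega⟩
    rw [show k + 3 - 1 = k + 2 by omega]
    nlinarith
  have hhi := ReqsideWeightLaws.ceilSqrt_le_of_le_sq hs
  unfold sqrtLen
  omega

/-- K2-SQRT is a DEEPER truncation than K2-HALF: `⌈√l⋆⌉ ≤ ⌈l⋆/2⌉` for `l⋆ ≥ 3` (equality exactly for `3 ≤ l⋆ ≤ 6`, i.e. at the bed primes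
`l = 7, 11, 13` with `L = 2, 3, 3`; strict from `l = 17` on, e.g. `8 < 27` at `l = 107`, `15 < 99` at `l = 397`). [folklore] -/
theorem sqrtLen_le_halfLen {lstar : ℕ} (h : 3 ≤ lstar) : sqrtLen lstar ≤ halfLen lstar := by
  have hs : lstar ≤ ((lstar + 1) / 2) ^ 2 := by
    rcases Nat.even_or_odd lstar with ⟨k, hk⟩ | ⟨k, hk⟩
    · subst hk
      rw [show (k + k + 1) / 2 = k by omega]
      nlinarith [show 2 ≤ k by omega]
    · subst hk
      rw [show (2 * k + 1 + 1) / 2 = k + 1 by omega]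
      nlinarith
  exact ReqsideWeightLaws.ceilSqrt_le_of_le_sq hs

/-- The three K2-SQRT configurations at the worked prime `l = 107` (`l⋆ = 53`, `L = 8`, `meanSq 8 = 51/2`): the `L`-label reading
`λ_8(27/64) = 1941/128 ≈ 15.16`, `λ_8(1/2) = 53/4 = 13.25`, `λ_8(3/4) = 57/8 = 7.125`; the full-label reading (`L = l⋆ = 53`, `meanSq 53 = 963 = l(l+1)/12`)
`λ(27/64) = 17829/32 ≈ 557.16`, `λ(1/2) = 482`, `λ(3/4) = 483/2 = 241.5` = REQB-TABLE v1 col 24 (abc-iut-reqb-rf-1 [L4]). [folklore] -/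
theorem lamOf_sqrt_worked :
    sqrtLen 53 = 8 ∧ meanSq 8 = 51 / 2 ∧
      lamOf (27 / 64) 8 = 1941 / 128 ∧ lamOf (1 / 2) 8 = 53 / 4 ∧ lamOf (3 / 4) 8 = 57 / 8 ∧
      meanSq 53 = 963 ∧ lamOf (27 / 64) 53 = 17829 / 32 ∧ lamOf (1 / 2) 53 = 482 ∧ lamOf (3 / 4) 53 = 483 / 2 := by
  refine ⟨sqrtLen_numerals.2.1, ?_, ?_, ?_, ?_, ?_, ?_, ?_, ?_⟩ <;> norm_num [lamOf, meanSq]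

section SqrtInterface

variable {T : ThetaIndex} {S : Situation T} (P : Cor312.Setting S)

/-- **(HYPOTHETICAL) THE K2-SQRT STATEMENT** at q-exponent `λ`: `TruncStatement P ⌈√l⋆⌉ λ` — «`−|log(Θ)|_L ∈ ℝ` and `λ·(−|log(q)|_L) ≤ −|log(Θ)|_L`»
with the averages over the labels `j = 1,…,⌈√l⋆⌉` only (CFG-10/11/12: `μ₀ = 27/64, 1/2, 3/4`; sheets' B2 + B5: what an `L`-value Θ-pilot, its
`Θ^{×μ}_{LGP}`-type link and its multiradial representation would have to make a THEOREM). Hypothetical READING over our typed setting; no printed object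
for `L < l⋆`. [claim: Mochizuki2012, status: disputed] -/
@[claim "Mochizuki2012" "disputed"]
def SqrtStatement (lam : ℝ) : Prop := TruncStatement P (sqrtLen T.lstar) lam

/-- Unfolding (bookkeeping). [folklore] -/
theorem sqrtStatement_iff (lam : ℝ) : SqrtStatement P lam ↔ TruncStatement P (sqrtLen T.lstar) lam := Iff.rfl

end SqrtInterface

/-- **(R1⋇) DECIDED FALSE for `L = ⌈√l⋆⌉` at every prime `l ≥ 7`** (`truncatedLabels_closed_iff`, p513512: closed ⟺ `L = 1 ∨ L = l⋆`, and
`2 ≤ ⌈√l⋆⌉ ≤ l⋆ − 1`) — the sheets' (c) C1 first half (`truncatedLabels_two_mul_escapes`: the explicit escaping product `2·(⌊L/2⌋+1)`). [folklore] -/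
theorem sqrtLabelsProductClosed_iff_false (l : ℕ) (hp : l.Prime) (h7 : 7 ≤ l) :
    TruncLabelsProductClosed l (sqrtLen ((l - 1) / 2)) ↔ False := by
  rw [iff_false]
  intro h
  have hw := sqrtLen_window (lstar := (l - 1) / 2) (by omega)
  have key := (ReqsideLabelsNoSymmetry.truncatedLabels_closed_iff l (sqrtLen ((l - 1) / 2)) hp (by omega) (by omega)
    (by omega)).1 h
  omega

/-- **(R1±) DECIDED FALSE for `L = ⌈√l⋆⌉` at every prime `l ≥ 7`** (then `5 ≤ 2L+1 ≤ l − 2`; `affPM_no_midsize_orbit`, p529840) — the sheets' (c) C1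
second half: no transitive `x ↦ ±x + a` symmetry on `2L+1` cusp labels. [folklore] -/
theorem sqrtPMLabelsAreOrbit_false (l : ℕ) (hp : l.Prime) (h7 : 7 ≤ l) : ¬ TruncPMLabelsAreOrbit l (sqrtLen ((l - 1) / 2)) := by
  have hw := sqrtLen_window (lstar := (l - 1) / 2) (by omega)
  exact truncPMLabelsAreOrbit_false l _ hp (by omega) (by omega)

open ReqsideWeightLaws in
/-- **B6: `u(l, L) > 6(L − 2)` on every K2-SQRT row** (`2 ≤ L`, `(L−1)² < l⋆ = (l−1)/2`, so `l ≥ 2(L−1)² + 3`; with §4's closed form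
`u = 6l(L+3)/((2L+5)(L−1))` and `(2(L−1)²+3)(L+3) − (L−2)(2L+5)(L−1) = 3L² + 4L + 5 > 0`): the downstream display constant grows at least linearly in
`L = ⌈√l⋆⌉`, hence is NOT bounded along the family — no `l`-uniform `Λ` for a `Thm110LegendreWith Λ`-shape conclusion (sheets' B6 / (c) C4;
cf. `ReqsideLabelsInd.decoupledConstant_gt`: `u > 3l/L`). [folklore] -/
theorem six_mul_lt_uConst_sq_sqrtRow {l L : ℕ} (hL : 2 ≤ L) (hrow : (L - 1) ^ 2 < (l - 1) / 2) :
    6 * ((L : ℝ) - 2) < uConst (fun j => (j : ℤ) ^ 2) 1 l L := by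
  rw [uConst_sq_trunc l hL]
  have h1 : 2 * (L - 1) ^ 2 + 3 ≤ l := by omega
  have h2 : 2 * ((L : ℝ) - 1) ^ 2 + 3 ≤ (l : ℝ) := by
    have := (Nat.cast_le (α := ℝ)).mpr h1
    push_cast [Nat.cast_sub (show 1 ≤ L by omega)] at this
    linarith
  have hL' : (2 : ℝ) ≤ L := by exact_mod_cast hL
  have hden : 0 < (2 * (L : ℝ) + 5) * ((L : ℝ) - 1) := by nlinarith
  rw [lt_div_iff₀ hden]
  have h3 : (2 * ((L : ℝ) - 1) ^ 2 + 3) * ((L : ℝ) + 3) ≤ (l : ℝ) * ((L : ℝ) + 3) :=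
    mul_le_mul_of_nonneg_right h2 (by linarith)
  nlinarith [h3]

open ReqsideWeightLaws in
/-- On the sqrt rows `u` exceeds K2-HALF's limit `12` as soon as `L ≥ 4` (`l ≥ 23`) and print's limit `6` as soon as `L ≥ 3` (`l ≥ 11`) (from
`six_mul_lt_uConst_sq_sqrtRow`; at `L = 2`, `l = 7` both families coincide: `u = 70/3`). [folklore] -/
theorem twelve_lt_uConst_sq_sqrtRow {l L : ℕ} (hL : 4 ≤ L) (hrow : (L - 1) ^ 2 < (l - 1) / 2) :
    12 < uConst (fun j => (j : ℤ) ^ 2) 1 l L := by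
  have h := six_mul_lt_uConst_sq_sqrtRow (l := l) (by omega) hrow
  have hL' : (4 : ℝ) ≤ L := by exact_mod_cast hL
  linarith

open ReqsideWeightLaws in
/-- **NUMERALS at the two ends of the bed and at the worked prime** (`(l, L)` = `(7, 2)`, `(107, 8)`, `(397, 15)`):
`u = 70/3 = 23.33`, `2354/49 = 48.04`, `21438/245 = 87.50` (K2-HALF at the same `l`: `23.33`, `12.555`, `12.213`; print: `11.45`, `6.229`, `6.059`). [folklore] -/
theorem uConst_sq_sqrt_numerals :
    uConst (fun j => (j : ℤ) ^ 2) 1 7 2 = 70 / 3 ∧ uConst (fun j => (j : ℤ) ^ 2) 1 107 8 = 2354 / 49 ∧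
      uConst (fun j => (j : ℤ) ^ 2) 1 397 15 = 21438 / 245 := by
  refine ⟨?_, ?_, ?_⟩ <;> (rw [uConst_sq_trunc _ (by norm_num)]; norm_num)

end Summit.ABC.IUTFork.Repair.RH.AxisCK2Requirements
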